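/-
Copyright (c) 2026 the pub-hodgecm-mathlib formalisation cell (harness21).  Prover seat hodgecm-mathlib-LH4-p13 (g8), req620 Track A «(D-RAM) FOUR-FRAME» squad, tier 0,
STAGE-1b (dealer LH4-plan (g13) WORD #91 «B2b-2»; LH4-p05 (g8) 13:22:48Z «DELIVER PER STRATUM»): brick (L-lab-20c) «THE TWO-SLOT LABEL READ ON THE GLUED STRATA»: for `b ≥ 1`
the sum `A` is on top automatically, and on the κG representative `V(1,1,g)` with its explicit polarisation `D(g) = π₀^{−(ρ+t′)}·(g, 1, −(1+g)⁻¹)` (★ κG-A1) the value-class label of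
the class `D(g)·u` reads `ω(u₀·g·g_α + u₁·g_β)` — the constants `C₀, C₁` of LH4-p14's B3 character sum, by name.  2026-09-04.
-/
import Summits.HodgeConjecture.HodgeConjecture.Theorems.F0P3cDyRamTwoSlotLabelRead            -- ★ p860509 (this seat, (L-lab-20a)): `valueClassLabel_latt_hnf_iff_normSign_linear`; brings ★ p860449 `top_A_or_top_C…`
import Summits.HodgeConjecture.HodgeConjecture.Theorems.F0P3cDyRamDiagonalKappaGluedClassForm  -- ★ κG-A1 (LH4-p09 lineage): `isVertexLattice_zero_latt_glued_rep` (the polarisation `D(g)`); brings ★ `normSign_mul_norm`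
import HarnessLib

/-!
# Crux `H413`, line LH4 «(D-RAM) FOUR-FRAME», STAGE-1b — (L-lab-20c) «THE TWO-SLOT LABEL READ ON THE GLUED STRATA AND ON `V(1,1,g)`»

Cell `hodgecm-mathlib` (D-0151), FLOOR 0, crux item H413 = `stmt-HodgeConjecture-24833`, route of record `HCCMUnconditional`; squad F0∕P3c∕LH4.  THEOREMS ONLY (no `def`, no
instance, no notation, no `sorry`, default heartbeats), ★-only imports, lane `--supports stmt-HodgeConjecture-24833`.

* §1 `v_A_eq_of_one_le` — on a clean-shell normalised HNF vertex with `b ≥ 1` the `v⁰`-entry `A` is on top (★ p860449 `top_A_or_top_C_of_clean_shell_latt_hnf`: the other branch has `b = 0`);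
  **`valueClassLabel_latt_hnf_iff_normSign_linear_of_one_le`** — ★ (L-lab-20a)'s linear read with `hA` replaced by `1 ≤ b` (every glued stratum).
* §2 **`valueClassLabel_glued_rep_iff_normSign`** — on `latt V(1,1,g)` (`V = [[1,0,0],[1,ϖ^ρ,0],[1+g,ϖ^ρ,ϖ^{2ρ+2t′}]]`, `ρ ≥ 1`) with a type-0 polarisation `D`: the label is
  `ω(D₀·g_α + D₁·g_β)`; **`valueClassLabel_glued_rep_class_iff_normSign`** — for the class `D = D(g)·u` (`u` σ-fixed units): the label is `ω(u₀·g·g_α + u₁·g_β)` (the norm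
  `π₀^{−(ρ+t′)}` drops out of `ω`).  With ★ (L-lab-20b) `two_mul_labelledOddCount_eq_sum_of_classSign`: `2·m^L_i(V) = ω(D(g)_i)·Σ_{r ∈ R} ω(r_i)(1 + ω(r₀·g·g_α + r₁·g_β))`.

HONEST LABEL: count-neutral (the per-stratum label constants for the (β-BAL) Stage-B glued sums; the representative system `R` and the sum are B3's).  HC_CM remains proved only
modulo the printed citations (2 remaining named inputs: hLiu418 = `stmt-HodgeConjecture-24832`, h413 = `stmt-HodgeConjecture-24833`) until rung 0 closes.
-/

noncomputable section

namespace Summit.HodgeConjecture.HodgeConjecture.Cruxes.H413.F0P3cDyRamTwoSlotLabelReadGlued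

open Literature.NumberTheory.Automorphic Literature.NumberTheory.Automorphic.HermitianLattice Literature.NumberTheory.Automorphic.UnitaryGroup
open Literature.NumberTheory.Automorphic.UnitaryLatticeTree Literature.NumberTheory.Automorphic.UnitaryThreeFourFrame
open Literature.NumberTheory.LocalFields Literature.NumberTheory.LocalFields.WildQuadraticDatum
open Summit.HodgeConjecture.HodgeConjecture.Cruxes.H413.F0P3cDyRamFourFramePieces
open Summit.HodgeConjecture.HodgeConjecture.Cruxes.H413.F0P3cDyRamFourFrameCensusDefs
open Summit.HodgeConjecture.HodgeConjecture.Cruxes.H413.F0P3cDyRamDiagonalTorusDefs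
open Summit.HodgeConjecture.HodgeConjecture.Cruxes.H413.F0P3cDyRamLabelledOddCountDefs (valueClassLabel)
open Summit.HodgeConjecture.HodgeConjecture.Cruxes.H413.F0P3cDyRamUniformizerPowerTube (v_pow_eq_exp_neg)
open Summit.HodgeConjecture.HodgeConjecture.Cruxes.H413.F0P3cDyRamLabelClassOfStratum (top_A_or_top_C_of_clean_shell_latt_hnf)
open Summit.HodgeConjecture.HodgeConjecture.Cruxes.H413.F0P3cDyRamTwoSlotLabelRead (valueClassLabel_latt_hnf_iff_normSign_linear)
open Summit.HodgeConjecture.HodgeConjecture.Cruxes.H413.F0P3cDyRamFixedCountDiagonalModel (normSign_mul_norm)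
open scoped Valued WithZero Matrix MatrixGroups
open WithZero

variable {K : Type} [Field K] [Valued K ℤᵐ⁰]

/-! ## §1  On the glued strata (`b ≥ 1`) the sum `A` is on top -/

/-- **`b ≥ 1` ⟹ `|A| = |ϖ^ℓ|`** on the clean shell of a normalised HNF vertex (★ p860449: the only other branch has `b = 0`). [cite: Kottwitz1986BaseChangeUnits, §1 pp. 240–241] [cite: Jacobowitz1962, §4, §7] -/
theorem v_A_eq_of_one_le {σ : K →+* K} {ϖ : K} {d t : ℕ} (hDat : IsRamifiedQuadraticDatum σ ϖ d t)
    {D : Fin 3 → K} (hDσ : ∀ i, σ (D i) = D i) (hD0 : ∀ i, D i ≠ 0) {b c : ℕ} {x y z : K} (hx : Valued.v x ≤ 1) (hy : Valued.v y ≤ 1) (hz : Valued.v z ≤ 1)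
    (hn : IsNormalisedLattice (latt (Matrix.of ![![1, 0, 0], ![x, ϖ ^ b, 0], ![y, z, ϖ ^ c]])))
    (hM : IsVertexLattice σ ϖ (Matrix.diagonal D) 0 (latt (Matrix.of ![![1, 0, 0], ![x, ϖ ^ b, 0], ![y, z, ϖ ^ c]])))
    {α β : K} {N₀ n₁ n₂ n₃ : ℕ} (hE : IsElementDatum σ ϖ N₀ α β n₁ n₂ n₃) {ℓ m mc : ℕ} (hℓN : ℓ + 1 ≤ N₀) (hmN : m ≤ N₀) (hℓmc : 2 * ℓ + 1 ≤ mc) (hmmc : m + ℓ ≤ mc)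
    (hlev : LatticeInLevel ϖ ℓ (Matrix.diagonal ![α - 1, β - 1, 0]) (latt (Matrix.of ![![1, 0, 0], ![x, ϖ ^ b, 0], ![y, z, ϖ ^ c]])))
    (hnlev : ¬ LatticeInLevel ϖ (ℓ + 1) (Matrix.diagonal ![α - 1, β - 1, 0]) (latt (Matrix.of ![![1, 0, 0], ![x, ϖ ^ b, 0], ![y, z, ϖ ^ c]])))
    (hsq : LatticeInLevel ϖ mc (Matrix.diagonal ![(α - 1) * (α - 1), (β - 1) * (β - 1), 0]) (latt (Matrix.of ![![1, 0, 0], ![x, ϖ ^ b, 0], ![y, z, ϖ ^ c]])))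
    (hb : 1 ≤ b) : Valued.v (D 0 * (α - 1) + D 1 * σ x * ((β - 1) * x)) = Valued.v (ϖ ^ ℓ) := by
  rcases top_A_or_top_C_of_clean_shell_latt_hnf hDat hDσ hD0 hx hy hz hn hM hE hℓN hmN hℓmc hmmc hlev hnlev hsq with h | ⟨-, hb0, -⟩
  · exact h
  · omega

/-- **THE TWO-SLOT LABEL READ ON A GLUED STRATUM (`b ≥ 1`)**: ★ (L-lab-20a) `valueClassLabel_latt_hnf_iff_normSign_linear` with the top hypothesis discharged by §1:
`valueClassLabel σ ϖ (α−1) (β−1) m* d L D ↔ normSign σ (D₀·g_α + D₁·N(x)·g_β) = 1`. [cite: Rogawski1990, §4.9 Prop. 4.9.1 (b) p. 55] [cite: Serre1979, Ch. V §3 Cor. 3]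
[cite: Kottwitz1986BaseChangeUnits, §1 pp. 240–241] -/
theorem valueClassLabel_latt_hnf_iff_normSign_linear_of_one_le [CompleteSpace K] {σ : K →+* K} {ϖ : K} {d t : ℕ} (hDat : IsRamifiedQuadraticDatum σ ϖ d t)
    {D : Fin 3 → K} (hDσ : ∀ i, σ (D i) = D i) (hD0 : ∀ i, D i ≠ 0) {b c : ℕ} {x y z : K} (hx : Valued.v x ≤ 1) (hy : Valued.v y ≤ 1) (hz : Valued.v z ≤ 1)
    (hn : IsNormalisedLattice (latt (Matrix.of ![![1, 0, 0], ![x, ϖ ^ b, 0], ![y, z, ϖ ^ c]])))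
    (hM : IsVertexLattice σ ϖ (Matrix.diagonal D) 0 (latt (Matrix.of ![![1, 0, 0], ![x, ϖ ^ b, 0], ![y, z, ϖ ^ c]])))
    {α β : K} {N₀ n₁ n₂ n₃ : ℕ} (hE : IsElementDatum σ ϖ N₀ α β n₁ n₂ n₃) {mc : ℕ} (hℓN : d % 2 + 1 ≤ N₀) (hmN : d % 2 + 2 * d - 1 ≤ N₀)
    (hℓmc : 2 * (d % 2) + 1 ≤ mc) (hmmc : d % 2 + 2 * d - 1 + d % 2 ≤ mc)
    (hlev : LatticeInLevel ϖ (d % 2) (Matrix.diagonal ![α - 1, β - 1, 0]) (latt (Matrix.of ![![1, 0, 0], ![x, ϖ ^ b, 0], ![y, z, ϖ ^ c]])))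
    (hnlev : ¬ LatticeInLevel ϖ (d % 2 + 1) (Matrix.diagonal ![α - 1, β - 1, 0]) (latt (Matrix.of ![![1, 0, 0], ![x, ϖ ^ b, 0], ![y, z, ϖ ^ c]])))
    (hsq : LatticeInLevel ϖ mc (Matrix.diagonal ![(α - 1) * (α - 1), (β - 1) * (β - 1), 0]) (latt (Matrix.of ![![1, 0, 0], ![x, ϖ ^ b, 0], ![y, z, ϖ ^ c]])))
    {T : GL (Fin 3) K} (hT : (T : Matrix (Fin 3) (Fin 3) K) = Matrix.diagonal ![α, β, 1])
    (hTM : mapGL T (latt (Matrix.of ![![1, 0, 0], ![x, ϖ ^ b, 0], ![y, z, ϖ ^ c]])) = latt (Matrix.of ![![1, 0, 0], ![x, ϖ ^ b, 0], ![y, z, ϖ ^ c]]))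
    (hb : 1 ≤ b) {gα gβ : K} (hσgα : σ gα = gα) (hσgβ : σ gβ = gβ)
    (hgα : Valued.v ((ϖ ^ (d % 2 + 2 * d - 1))⁻¹ * (D 0 * ((α - 1) - gα * ((ϖ - σ ϖ) * ((ϖ * σ ϖ) ^ ((d - d % 2) / 2))⁻¹)))) ≤ 1)
    (hgβ : Valued.v ((ϖ ^ (d % 2 + 2 * d - 1))⁻¹ * (D 1 * (x * σ x) * ((β - 1) - gβ * ((ϖ - σ ϖ) * ((ϖ * σ ϖ) ^ ((d - d % 2) / 2))⁻¹)))) ≤ 1) :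
    valueClassLabel σ ϖ (α - 1) (β - 1) (d % 2 + 2 * d - 1) d (latt (Matrix.of ![![1, 0, 0], ![x, ϖ ^ b, 0], ![y, z, ϖ ^ c]])) D ↔
      normSign σ (D 0 * gα + D 1 * (x * σ x) * gβ) = 1 :=
  valueClassLabel_latt_hnf_iff_normSign_linear hDat hDσ hD0 hx hy hz hn hM hE hℓN hmN hℓmc hmmc hlev hnlev hsq hT hTM
    (v_A_eq_of_one_le hDat hDσ hD0 hx hy hz hn hM hE hℓN hmN hℓmc hmmc hlev hnlev hsq hb) hσgα hσgβ hgα hgβ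

/-! ## §2  The κG representative `V(1,1,g)` -/

/-- **THE TWO-SLOT LABEL READ ON `latt V(1,1,g)`** (`V = [[1,0,0],[1,ϖ^ρ,0],[1+g,ϖ^ρ,ϖ^{2ρ+2t′}]]`, `ρ ≥ 1`, `|g| < 1`), any type-0 `σ`-fixed polarisation `D`, `T`-stable, clean shell:
`valueClassLabel … (latt V) D ↔ normSign σ (D₀·g_α + D₁·g_β) = 1` (§1 at `x = 1`: `N(x) = 1`). [cite: Rogawski1990, §4.9 Prop. 4.9.1 (b) p. 55] [cite: Serre1979, Ch. V §3 Cor. 3]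
[cite: Kottwitz1986BaseChangeUnits, §1 pp. 240–241] -/
theorem valueClassLabel_glued_rep_iff_normSign [CompleteSpace K] {σ : K →+* K} {ϖ : K} {d t : ℕ} (hDat : IsRamifiedQuadraticDatum σ ϖ d t)
    {ρ t' : ℕ} (hρ : 1 ≤ ρ) {g : K} (hg : Valued.v g < 1)
    (V : GL (Fin 3) K) (hV : (V : Matrix (Fin 3) (Fin 3) K) = !![1, 0, 0; 1, ϖ ^ ρ, 0; 1 * 1 + g, ϖ ^ ρ * 1, ϖ ^ (2 * ρ + 2 * t')])
    {D : Fin 3 → K} (hDσ : ∀ i, σ (D i) = D i) (hD0 : ∀ i, D i ≠ 0)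
    (hn : IsNormalisedLattice (latt (V : Matrix (Fin 3) (Fin 3) K))) (hM : IsVertexLattice σ ϖ (Matrix.diagonal D) 0 (latt (V : Matrix (Fin 3) (Fin 3) K)))
    {α β : K} {N₀ n₁ n₂ n₃ : ℕ} (hE : IsElementDatum σ ϖ N₀ α β n₁ n₂ n₃) {mc : ℕ} (hℓN : d % 2 + 1 ≤ N₀) (hmN : d % 2 + 2 * d - 1 ≤ N₀)
    (hℓmc : 2 * (d % 2) + 1 ≤ mc) (hmmc : d % 2 + 2 * d - 1 + d % 2 ≤ mc)
    (hlev : LatticeInLevel ϖ (d % 2) (Matrix.diagonal ![α - 1, β - 1, 0]) (latt (V : Matrix (Fin 3) (Fin 3) K)))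
    (hnlev : ¬ LatticeInLevel ϖ (d % 2 + 1) (Matrix.diagonal ![α - 1, β - 1, 0]) (latt (V : Matrix (Fin 3) (Fin 3) K)))
    (hsq : LatticeInLevel ϖ mc (Matrix.diagonal ![(α - 1) * (α - 1), (β - 1) * (β - 1), 0]) (latt (V : Matrix (Fin 3) (Fin 3) K)))
    {T : GL (Fin 3) K} (hT : (T : Matrix (Fin 3) (Fin 3) K) = Matrix.diagonal ![α, β, 1]) (hTM : mapGL T (latt (V : Matrix (Fin 3) (Fin 3) K)) = latt (V : Matrix (Fin 3) (Fin 3) K))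
    {gα gβ : K} (hσgα : σ gα = gα) (hσgβ : σ gβ = gβ)
    (hgα : Valued.v ((ϖ ^ (d % 2 + 2 * d - 1))⁻¹ * (D 0 * ((α - 1) - gα * ((ϖ - σ ϖ) * ((ϖ * σ ϖ) ^ ((d - d % 2) / 2))⁻¹)))) ≤ 1)
    (hgβ : Valued.v ((ϖ ^ (d % 2 + 2 * d - 1))⁻¹ * (D 1 * ((β - 1) - gβ * ((ϖ - σ ϖ) * ((ϖ * σ ϖ) ^ ((d - d % 2) / 2))⁻¹)))) ≤ 1) :
    valueClassLabel σ ϖ (α - 1) (β - 1) (d % 2 + 2 * d - 1) d (latt (V : Matrix (Fin 3) (Fin 3) K)) D ↔ normSign σ (D 0 * gα + D 1 * gβ) = 1 := by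
  obtain ⟨-, -, hϖ, -, -, -, -⟩ := id hDat
  have hϖ1 : Valued.v ϖ ≤ 1 := by rw [hϖ, ← exp_zero, exp_le_exp]; norm_num
  have h1g : Valued.v (1 * 1 + g) ≤ 1 := by rw [one_mul, Valued.v.map_one_add_of_lt hg]
  have hz : Valued.v (ϖ ^ ρ * 1) ≤ 1 := by rw [mul_one, map_pow]; exact pow_le_one₀ zero_le hϖ1
  rw [hV] at hn hM hlev hnlev hsq hTM ⊢
  have h := valueClassLabel_latt_hnf_iff_normSign_linear_of_one_le hDat hDσ hD0 (x := 1) (le_of_eq (map_one _)) h1g hz hn hM hE hℓN hmN hℓmc hmmc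
    hlev hnlev hsq hT hTM hρ hσgα hσgβ hgα (by rw [map_one, mul_one, mul_one]; exact hgβ)
  simpa only [map_one, mul_one] using h

/-- **THE LABEL OF THE CLASS `D(g)·u` ON `latt V(1,1,g)` IS `ω(u₀·g·g_α + u₁·g_β)`** — `D(g) = π₀^{−(ρ+t′)}·(g, 1, −(1+g)⁻¹)` the ★ κG-A1 polarisation, `u` σ-fixed units with
`diag(D(g)·u)` a type-0 polarisation (every class of `S_F(V)`); the common norm `π₀^{−(ρ+t′)} = N(ϖ^{−(ρ+t′)})` leaves `ω`.  This is the `lam` of ★ (L-lab-20b)'s class sum for the glued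
orbit: `2·m^L_i(V) = ω(D(g)_i)·Σ_{r ∈ R} ω(r_i)·(1 + ω(r₀·g·g_α + r₁·g_β))`. [cite: Rogawski1990, §4.9 Prop. 4.9.1 (b) p. 55] [cite: Serre1979, Ch. V §3 Cor. 3] [cite: Kottwitz1986BaseChangeUnits, §1 pp. 240–241] -/
theorem valueClassLabel_glued_rep_class_iff_normSign [CompleteSpace K] {σ : K →+* K} {ϖ : K} {d t : ℕ} (hDat : IsRamifiedQuadraticDatum σ ϖ d t)
    {ρ t' : ℕ} (hρ : 1 ≤ ρ) {g : K} (hg : Valued.v g < 1) (hg0 : g ≠ 0)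
    (V : GL (Fin 3) K) (hV : (V : Matrix (Fin 3) (Fin 3) K) = !![1, 0, 0; 1, ϖ ^ ρ, 0; 1 * 1 + g, ϖ ^ ρ * 1, ϖ ^ (2 * ρ + 2 * t')])
    (hσg : σ g = g) {u : Fin 3 → K} (hσu : ∀ i, σ (u i) = u i) (hu0 : ∀ i, u i ≠ 0)
    (hn : IsNormalisedLattice (latt (V : Matrix (Fin 3) (Fin 3) K)))
    (hM : IsVertexLattice σ ϖ (Matrix.diagonal fun j => (![((ϖ * σ ϖ) ^ (ρ + t'))⁻¹ * g, ((ϖ * σ ϖ) ^ (ρ + t'))⁻¹, -(((ϖ * σ ϖ) ^ (ρ + t'))⁻¹ * (1 + g)⁻¹)] : Fin 3 → K) j * u j) 0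
      (latt (V : Matrix (Fin 3) (Fin 3) K)))
    {α β : K} {N₀ n₁ n₂ n₃ : ℕ} (hE : IsElementDatum σ ϖ N₀ α β n₁ n₂ n₃) {mc : ℕ} (hℓN : d % 2 + 1 ≤ N₀) (hmN : d % 2 + 2 * d - 1 ≤ N₀)
    (hℓmc : 2 * (d % 2) + 1 ≤ mc) (hmmc : d % 2 + 2 * d - 1 + d % 2 ≤ mc)
    (hlev : LatticeInLevel ϖ (d % 2) (Matrix.diagonal ![α - 1, β - 1, 0]) (latt (V : Matrix (Fin 3) (Fin 3) K)))
    (hnlev : ¬ LatticeInLevel ϖ (d % 2 + 1) (Matrix.diagonal ![α - 1, β - 1, 0]) (latt (V : Matrix (Fin 3) (Fin 3) K)))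
    (hsq : LatticeInLevel ϖ mc (Matrix.diagonal ![(α - 1) * (α - 1), (β - 1) * (β - 1), 0]) (latt (V : Matrix (Fin 3) (Fin 3) K)))
    {T : GL (Fin 3) K} (hT : (T : Matrix (Fin 3) (Fin 3) K) = Matrix.diagonal ![α, β, 1]) (hTM : mapGL T (latt (V : Matrix (Fin 3) (Fin 3) K)) = latt (V : Matrix (Fin 3) (Fin 3) K))
    {gα gβ : K} (hσgα : σ gα = gα) (hσgβ : σ gβ = gβ)
    (hgα : Valued.v ((ϖ ^ (d % 2 + 2 * d - 1))⁻¹ * (((ϖ * σ ϖ) ^ (ρ + t'))⁻¹ * g * u 0 * ((α - 1) - gα * ((ϖ - σ ϖ) * ((ϖ * σ ϖ) ^ ((d - d % 2) / 2))⁻¹)))) ≤ 1)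
    (hgβ : Valued.v ((ϖ ^ (d % 2 + 2 * d - 1))⁻¹ * (((ϖ * σ ϖ) ^ (ρ + t'))⁻¹ * u 1 * ((β - 1) - gβ * ((ϖ - σ ϖ) * ((ϖ * σ ϖ) ^ ((d - d % 2) / 2))⁻¹)))) ≤ 1) :
    valueClassLabel σ ϖ (α - 1) (β - 1) (d % 2 + 2 * d - 1) d (latt (V : Matrix (Fin 3) (Fin 3) K))
        (fun j => (![((ϖ * σ ϖ) ^ (ρ + t'))⁻¹ * g, ((ϖ * σ ϖ) ^ (ρ + t'))⁻¹, -(((ϖ * σ ϖ) ^ (ρ + t'))⁻¹ * (1 + g)⁻¹)] : Fin 3 → K) j * u j) ↔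
      normSign σ (u 0 * g * gα + u 1 * gβ) = 1 := by
  obtain ⟨hσ, hvσ, hϖ, -, -, -, -⟩ := id hDat
  have hϖ0 : ϖ ≠ 0 := (Valuation.ne_zero_iff Valued.v).1 (by rw [hϖ]; exact exp_ne_zero)
  have hσϖ0 : σ ϖ ≠ 0 := (map_ne_zero σ).2 hϖ0
  have hπ0 : ((ϖ * σ ϖ) ^ (ρ + t') : K) ≠ 0 := pow_ne_zero _ (mul_ne_zero hϖ0 hσϖ0)
  have hσπ : σ ((ϖ * σ ϖ) ^ (ρ + t')) = (ϖ * σ ϖ) ^ (ρ + t') := by rw [map_pow, map_mul, hσ, mul_comm]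
  have h1g : Valued.v (1 + g) = 1 := Valued.v.map_one_add_of_lt hg
  have h1g0 : 1 + g ≠ 0 := fun h => by rw [h, map_zero] at h1g; exact zero_ne_one h1g
  set D : Fin 3 → K := fun j => (![((ϖ * σ ϖ) ^ (ρ + t'))⁻¹ * g, ((ϖ * σ ϖ) ^ (ρ + t'))⁻¹, -(((ϖ * σ ϖ) ^ (ρ + t'))⁻¹ * (1 + g)⁻¹)] : Fin 3 → K) j * u j
    with hDdef
  have hD0v : D 0 = ((ϖ * σ ϖ) ^ (ρ + t'))⁻¹ * g * u 0 := rfl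
  have hD1v : D 1 = ((ϖ * σ ϖ) ^ (ρ + t'))⁻¹ * u 1 := rfl
  have hD2v : D 2 = -(((ϖ * σ ϖ) ^ (ρ + t'))⁻¹ * (1 + g)⁻¹) * u 2 := rfl
  have hDσ : ∀ i, σ (D i) = D i := fun i => by
    fin_cases i
    · show σ (D 0) = D 0; rw [hD0v, map_mul, map_mul, map_inv₀, hσπ, hσg, hσu]
    · show σ (D 1) = D 1; rw [hD1v, map_mul, map_inv₀, hσπ, hσu]
    · show σ (D 2) = D 2; rw [hD2v, map_mul, map_neg, map_mul, map_inv₀, map_inv₀, hσπ, map_add, map_one, hσg, hσu]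
  have hD0 : ∀ i, D i ≠ 0 := fun i => by
    fin_cases i
    · show D 0 ≠ 0; rw [hD0v]; exact mul_ne_zero (mul_ne_zero (inv_ne_zero hπ0) hg0) (hu0 0)
    · show D 1 ≠ 0; rw [hD1v]; exact mul_ne_zero (inv_ne_zero hπ0) (hu0 1)
    · show D 2 ≠ 0; rw [hD2v]; exact mul_ne_zero (neg_ne_zero.2 (mul_ne_zero (inv_ne_zero hπ0) (inv_ne_zero h1g0))) (hu0 2)
  have h := valueClassLabel_glued_rep_iff_normSign hDat hρ hg V hV hDσ hD0 hn hM hE hℓN hmN hℓmc hmmc hlev hnlev hsq hT hTM hσgα hσgβ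
    (by rw [hD0v]; exact hgα) (by rw [hD1v]; exact hgβ)
  rw [h, hD0v, hD1v]
  -- pull the norm `π₀^{−(ρ+t′)} = N(ϖ^{−(ρ+t′)})` out of `ω`
  have hfac : ((ϖ * σ ϖ) ^ (ρ + t'))⁻¹ * g * u 0 * gα + ((ϖ * σ ϖ) ^ (ρ + t'))⁻¹ * u 1 * gβ =
      (u 0 * g * gα + u 1 * gβ) * ((ϖ ^ (ρ + t'))⁻¹ * σ ((ϖ ^ (ρ + t'))⁻¹)) := by
    rw [map_inv₀, map_pow, ← mul_inv, ← mul_pow]; ring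
  rw [hfac, normSign_mul_norm σ _ (inv_ne_zero (pow_ne_zero _ hϖ0))]

end Summit.HodgeConjecture.HodgeConjecture.Cruxes.H413.F0P3cDyRamTwoSlotLabelReadGlued

end
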